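import Summits.BirchSwinnertonDyer.Rank1Residual.AdditivePotMult.NonvanishingTwist
import Summits.BirchSwinnertonDyer.Rank1Residual.AdditivePotMult.ModelFreeClassTheorems
import Summits.BirchSwinnertonDyer.Rank1Residual.AdditivePotMult.GreenbergVatsalTwistExists
import Summits.BirchSwinnertonDyer.Rank1Residual.X2.RankOne
import Literature.NumberTheory.EllipticCurves.Rank1Residual.GVParityTwistTransportProofs
import Literature.NumberTheory.EllipticCurves.ComplexMultiplicationLFunctionTableProofs
import Literature.NumberTheory.EllipticCurves.BSDRootNumberLocalTablesProofs
import Literature.NumberTheory.QuadraticFields.FundamentalDiscriminant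
import HarnessLib

/-!
# X3♯(M): the rank-zero Greenberg–Vatsal `p`-multiplicative twist EXISTS — `BSD(E,p)` from the
# over-`K` input over quadratic fields, for EVERY X3♯(M) pair (no census datum left)

HONEST FRAMING (cell `b2b-bsdres`, run/shared/lean/b2b/bsd-rank1-residual/, verbatim in every
file): the goal of the cell is to DELETE the COMBINATION-SHAPED residual classes of the
Birch–Swinnerton-Dyer formula for ALL analytic-rank `≤ 1` elliptic curves over `ℚ` — "full BSD
formula for every rank `≤ 1` curve in class `C`" assembled STRICTLY from published theorems — so
that the rank-`≤ 1` remainder becomes exactly the CONSTRUCTION-SHAPED classes, which are TYPED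
(missing-input `Prop`s), NOT attempted. This is not "finishing BSD". Sub-cell
`b2b-bsdres-additive-p1` (CLASS-OWNERS row "X3/X4 additive — pot. multiplicative / X3♯(M)"),
generation 3; research route, no claim beyond the stated sub-classes; X3♯(M) REMAINS
CONSTRUCTION-SHAPED.

Theorems only; no definition, no new named fact. Generations 0–2 proved: for `(E,p) ∈ X3♯(M)`
(odd additive Eisenstein prime `p`, `ord_p j(E) < 0`) and a quadratic field `K` whose twist
`E^{(d_K)}` is `p`-multiplicative with `L(E^{(d_K)},1) ≠ 0` and gvpar, `BSD(E,p)` follows from the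
typed over-`K` input `MissingPPartOverCAt (W.baseChange K) p` ALONE
(`bsdp_of_classX3M_of_gvPar_rankZero_twist'`), and exhibited such `K` for every census pair
(517 ‖ 298; REPORT §6.4). Here the existence of `K` becomes a THEOREM for every X3♯(M) pair:

* `ClassX3M.exists_gvPar_rankZero_mult_twist` — for `(E,p) ∈ X3♯(M)` there are a quadratic field
  `K` and a globally minimal model `Wd` of `E^{(d_K)}` with `Mult Wd p`, `GVPar Wd p` and
  `r_an(Wd) = 0`. Proof: a `p`-multiplicative gvpar twist `E^{(d)}` exists (gen 2,
  `ClassX3M.exists_mult_gvPar_twist`); by the twist supply (`exists_twist_L_ne_zero_of_sign`, sign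
  `+1`: Hoffstein–Luo 1997 + the twist root number from Modularity) there is a square-free `n > 0`,
  `p ∤ n`, with `L((E^{(d)})^{(n)}, 1) ≠ 0`; an EVEN twist unramified at `p` keeps multiplicative
  reduction at `p` (X2 owner's `hasMultiplicativeReductionAtPrime_of_smul_eq_quadraticTwist`) and
  gvpar (`gvPar_twist_iff_of_pos`, Greenberg–Vatsal 2000, remark after Thm. 1.3); `K = ℚ(√(dn))`.
* **`bsdp_of_classX3M`** — for EVERY `(E,p) ∈ X3♯(M)` of analytic rank `≤ 1`:
  `BSD(E,p)` follows from the over-`K` input granted over every quadratic field `K` whose twist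
  `E^{(d_K)}` is `p`-multiplicative (for such `K`, `p` ramifies in `K` and `E_K` is multiplicative
  above `p`), together with the published inputs already carried by the gen-0/2 theorems
  (Greenberg–Vatsal 2000 [flag `GV00-mult-asserted`], Wuthrich 2014 Thm. 16, Stein–Wuthrich 2013,
  Greenberg–Stevens, Milne 1972 any-model, GZK, modularity, Hoffstein–Luo 1997).
  `bsdp_of_classX3M_of_forall_quadratic` is the same with the plainer hypothesis "the `p`-part of
  BSD for `E` over every quadratic field"; `missingPPartAt_of_classX3M` the Partition currency.

So X3♯(M) is, pair by pair and now uniformly in the kernel, EXACTLY the statement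
"`p`-part of BSD for `E/K`, `K` quadratic ramified at `p` with `E_K` multiplicative above `p`" —
printed nowhere (REPORT §4, §6.3): the class stays CONSTRUCTION-SHAPED with one typed input and no
per-pair side datum.
-/

noncomputable section

open scoped Classical

open WeierstrassCurve Literature.NumberTheory.EllipticCurves
  Literature.NumberTheory.EllipticCurves.ModularForms
  Literature.NumberTheory.EllipticCurves.Rank1Residual
  Literature.NumberTheory.EllipticCurves.Rank1Residual.Typed
  Literature.NumberTheory.EllipticCurves.GreenbergVatsal2000
  Literature.NumberTheory.EllipticCurves.Wuthrich2014
  Literature.NumberTheory.EllipticCurves.SteinWuthrich2013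
  IsDedekindDomain

namespace Summit.BirchSwinnertonDyer.Rank1Residual.AdditivePotMult

/-! ### §1 Helpers: global minimal models of twists, `p ‖ N` at a multiplicative prime, the
### quadratic field of a square-free integer -/

/-- A globally minimal `ℚ`-model of the twist `E^{(d)}` (Néron; tree `hasGlobalMinimalModel_rat_holds`,
Silverman *AEC* VIII.8.3). [folklore] -/
theorem exists_globallyMinimal_model_twist (W : WeierstrassCurve ℚ) [W.IsElliptic] {d : ℚ}
    (hd : d ≠ 0) :
    ∃ (Wd : WeierstrassCurve ℚ) (_ : Wd.IsElliptic) (_ : Wd.IsGloballyMinimal) (C : VariableChange ℚ),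
      C • W.quadraticTwist d = Wd := by
  haveI := W.isElliptic_quadraticTwist hd
  obtain ⟨C, hC⟩ := hasGlobalMinimalModel_rat_holds (W.quadraticTwist d)
  exact ⟨C • W.quadraticTwist d, inferInstance, hC, C, rfl⟩

/-- `p² ∤ N_E` at a prime of multiplicative reduction (conductor exponent `1`; Silverman *ATAEC*
IV.10.2(c): `p² ∣ N_E` iff additive at the place over `p`, tree
`natGenerator_sq_dvd_conductorNorm_iff`). [cite: Silverman1994, IV.10.2(c)] -/
theorem not_sq_dvd_conductorNorm_of_mult' (W : WeierstrassCurve ℚ) [W.IsElliptic] {p : ℕ}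
    [Fact p.Prime] (hmult : Mult W p) : ¬ p ^ 2 ∣ W.conductorNorm ℤ := by
  have hp : p.Prime := Fact.out
  set P : Nat.Primes := ⟨p, hp⟩ with hP
  set v : HeightOneSpectrum ℤ := (Rat.HeightOneSpectrum.primesEquiv (R := ℤ)).symm P with hv
  have hgen : Rat.HeightOneSpectrum.natGenerator v = p :=
    congrArg Subtype.val ((Rat.HeightOneSpectrum.primesEquiv (R := ℤ)).apply_symm_apply P)
  have hmv : W.HasMultiplicativeReductionAt v :=
    (W.hasMultiplicativeReductionAtPrime_iff_hasMultiplicativeReductionAt_holds P).mp hmult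
  intro h
  rw [← hgen] at h
  exact hmv.not_hasAdditiveReductionAt ((natGenerator_sq_dvd_conductorNorm_iff v W).mp h)

/-- `p ∣ N_E` at a prime of multiplicative reduction (bad reduction; tree
`dvd_conductorNorm_iff_not_hasGoodReductionAtPrime`). [cite: Silverman1994, IV.10.2(a)] -/
theorem dvd_conductorNorm_of_mult (W : WeierstrassCurve ℚ) [W.IsElliptic] {p : ℕ} [Fact p.Prime]
    (hmult : Mult W p) : p ∣ W.conductorNorm ℤ :=
  (W.dvd_conductorNorm_iff_not_hasGoodReductionAtPrime p).mpr
    (WeierstrassCurve.HasMultiplicativeReduction.not_hasGoodReduction (R := ℤ_[p]) hmult)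

/-- **The quadratic field of a square-free integer `t ≠ 1`**: a quadratic number field `K` with
`d_K = t` (if `t ≡ 1 (mod 4)`) or `d_K = 4t` (if `t ≡ 2, 3 (mod 4)`), i.e. `K = ℚ(√t)` (tree
`Quadratic.exists_numberField_discr_eq`; Marcus Ch. 2 Thm. 1). [folklore] -/
theorem exists_quadraticField_of_squarefree {t : ℤ} (ht : Squarefree t) (ht1 : t ≠ 1) :
    ∃ (K : Type) (_ : Field K) (_ : NumberField K), Module.finrank ℚ K = 2 ∧
      (NumberField.discr K = t ∨ NumberField.discr K = 4 * t) := by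
  by_cases h4 : t % 4 = 1
  · obtain ⟨K, iF, iN, h2, hK⟩ :=
      Literature.NumberTheory.QuadraticFields.Quadratic.exists_numberField_discr_eq
        (D := t) (Or.inl ⟨h4, ht, ht1⟩)
    exact ⟨K, iF, iN, h2, Or.inl hK⟩
  · have ht0 : t % 4 ≠ 0 := by
      intro h0
      have h22 : (2 : ℤ) * 2 ∣ t := by
        have : (4 : ℤ) ∣ t := Int.dvd_of_emod_eq_zero h0
        simpa [show (2 : ℤ) * 2 = 4 by norm_num] using this
      have hu := ht 2 h22
      rcases Int.isUnit_iff.mp hu with h | h <;> norm_num at h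
    have hlt : t % 4 < 4 := Int.emod_lt_of_pos t (by norm_num)
    have hge : 0 ≤ t % 4 := Int.emod_nonneg t (by norm_num)
    have h23 : t % 4 = 2 ∨ t % 4 = 3 := by omega
    have hdiv : 4 * t / 4 = t := by rw [Int.mul_ediv_cancel_left _ (by norm_num : (4 : ℤ) ≠ 0)]
    obtain ⟨K, iF, iN, h2, hK⟩ :=
      Literature.NumberTheory.QuadraticFields.Quadratic.exists_numberField_discr_eq
        (D := 4 * t) (Or.inr ⟨dvd_mul_right 4 t, by rw [hdiv]; exact h23, by rw [hdiv]; exact ht⟩)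
    exact ⟨K, iF, iN, h2, Or.inr hK⟩

/-! ### §2 X3♯(M): the rank-zero gvpar `p`-multiplicative twist exists -/

variable {W : WeierstrassCurve ℚ} [W.IsElliptic] {p : ℕ} [Fact p.Prime]

/-- **For `(E,p) ∈ X3♯(M)` the X2a twist pair EXISTS** (theorem-level form of census §6.4, REPORT):
assuming the Modularity Theorem (`hnf`) and Hoffstein–Luo 1997 (`hHL`), there are a quadratic field
`K` and a globally minimal model `Wd` of `E^{(d_K)}` which is multiplicative at `p`, satisfies the
Greenberg–Vatsal parity condition, and has `L(E^{(d_K)}, 1) ≠ 0` (analytic rank `0`). Proof: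
gen 2's `ClassX3M.exists_mult_gvPar_twist` (a `p`-multiplicative gvpar twist `E^{(d)}`), the twist
supply `exists_twist_L_ne_zero_of_sign` with sign `+1` applied to a globally minimal model of
`E^{(d)}` (`p ‖` its conductor), the transport of multiplicative reduction and of gvpar along an
even twist `n > 0` unramified at `p` (`X2.hasMultiplicativeReductionAtPrime_of_smul_eq_quadraticTwist`,
`gvPar_twist_iff_of_pos`), and `K = ℚ(√t)` for the square-free part `t` of `d n` (`t ≠ 1` since `E`
itself is additive at `p`). [folklore] -/
theorem ClassX3M.exists_gvPar_rankZero_mult_twist [W.IsGloballyMinimal] (hX : ClassX3M W p)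
    (hnf : exists_isNewformOf) (hHL : HoffsteinLuo1997_exists_twist_L_one_ne_zero) :
    ∃ (K : Type) (_ : Field K) (_ : NumberField K) (Wd : WeierstrassCurve ℚ) (_ : Wd.IsElliptic)
      (_ : Wd.IsGloballyMinimal), Module.finrank ℚ K = 2 ∧
      (∃ C : VariableChange ℚ, C • W.quadraticTwist (NumberField.discr K : ℚ) = Wd) ∧
      Mult Wd p ∧ GVPar Wd p ∧ Wd.analyticRank = 0 := by
  have hp : p.Prime := Fact.out
  have hp2 : p ≠ 2 := hX.2.2
  -- Step 1: a `p`-multiplicative gvpar twist, globally minimal model `W₁`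
  obtain ⟨d, hd0, hall⟩ := hX.exists_mult_gvPar_twist
  obtain ⟨W₁, _, _, C₁, hC₁⟩ := exists_globallyMinimal_model_twist W hd0
  obtain ⟨hmult₁, hgv₁⟩ := hall W₁ C₁ hC₁
  -- Step 2: `p ‖ N_{W₁}`
  have hpN : p ∣ W₁.conductorNorm ℤ := dvd_conductorNorm_of_mult W₁ hmult₁
  have hpN2 : ¬ p ^ 2 ∣ W₁.conductorNorm ℤ := not_sq_dvd_conductorNorm_of_mult' W₁ hmult₁
  -- Step 3: a positive non-vanishing twist unramified at `p`
  obtain ⟨n, -, -, -, hnsign, hpn, -, hL⟩ :=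
    exists_twist_L_ne_zero_of_sign hnf hHL W₁ hp hp2 hpN hpN2 ∅ (s := 1) (Or.inl rfl) 0
  have hn0 : 0 < n := Int.sign_eq_one_iff_pos.mp hnsign
  have hnQ : ((n : ℤ) : ℚ) ≠ 0 := by exact_mod_cast hn0.ne'
  -- Step 4: the globally minimal model `Wd` of `W₁^{(n)}`
  haveI := W₁.isElliptic_quadraticTwist hnQ
  obtain ⟨Wd, iWd, iWdm, C₂, hC₂⟩ := exists_globallyMinimal_model_twist W₁ hnQ
  have hC₂': C₂⁻¹ • Wd = W₁.quadraticTwist ((n : ℤ) : ℚ) := by rw [← hC₂, inv_smul_smul]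
  have hmultd : Mult Wd p :=
    X2.hasMultiplicativeReductionAtPrime_of_smul_eq_quadraticTwist W₁ Wd hC₂' p hp2 hpn hmult₁
  have hgvd : GVPar Wd p := (gvPar_twist_iff_of_pos hp2 hn0 hpn C₂⁻¹ hC₂').mpr hgv₁
  have hr0 : Wd.analyticRank = 0 := by
    rw [← hC₂, analyticRank_smul]
    exact analyticRank_eq_zero_of_entireLFunction_one_ne_zero _ hL
  -- Step 5: `Wd` is a model of `W^{(d n)}`
  have hmodel : ∃ C : VariableChange ℚ, C • W.quadraticTwist (d * ((n : ℤ) : ℚ)) = Wd := by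
    refine ⟨C₂ * ⟨C₁.u, ((n : ℤ) : ℚ) * C₁.r, 0, 0⟩, ?_⟩
    rw [mul_smul, ← quadraticTwist_quadraticTwist, ← quadraticTwist_smul, hC₁, hC₂]
  -- Step 6: square-free part `t` of `d n`; `t ≠ 1` because `E` is additive at `p`
  obtain ⟨c, t, hc, ht, hdn⟩ := Rat.exists_sq_mul_squarefree (mul_ne_zero hd0 hnQ)
  obtain ⟨C₃, hC₃⟩ := hmodel
  obtain ⟨C₆, hC₆⟩ := W.exists_variableChange_quadraticTwist_mul_sq (t : ℚ) c hc
  have hWt : (C₃ * C₆) • W.quadraticTwist (t : ℚ) = Wd := by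
    rw [mul_smul, hC₆, ← hC₃, hdn, mul_comm]
  have ht1 : t ≠ 1 := by
    rintro rfl
    apply hX.2.1.not_mult
    obtain ⟨C₄, hC₄⟩ := W.exists_variableChange_quadraticTwist_one
    rw [Int.cast_one] at hWt
    have hWd : (C₃ * C₆ * C₄) • W = Wd := by rw [mul_smul, hC₄]; exact hWt
    rw [← hWd] at hmultd
    exact (hasMultiplicativeReductionAtPrime_smul_iff W (C₃ * C₆ * C₄) p).mp hmultd
  obtain ⟨K, iF, iN, h2, hdisc⟩ := exists_quadraticField_of_squarefree ht ht1
  refine ⟨K, iF, iN, Wd, iWd, iWdm, h2, ?_, hmultd, hgvd, hr0⟩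
  rcases hdisc with hK | hK
  · exact ⟨C₃ * C₆, by rw [hK]; exact hWt⟩
  · obtain ⟨C₇, hC₇⟩ := W.exists_variableChange_quadraticTwist_mul_sq (t : ℚ) 2 two_ne_zero
    refine ⟨C₃ * C₆ * C₇⁻¹, ?_⟩
    have h4t : (((4 * t : ℤ)) : ℚ) = (t : ℚ) * 2 ^ 2 := by push_cast; ring
    rw [hK, h4t, ← hC₇, mul_smul, inv_smul_smul, hWt]

/-! ### §3 The class theorems for X3♯(M), uniform over all pairs -/

/-- **X3♯(M) ⇐ the over-`K` input over quadratic fields — for EVERY pair.** Let `(E,p) ∈ X3♯(M)`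
(`W` globally minimal, `p` an odd additive Eisenstein prime with `ord_p j(E) < 0`) have analytic
rank `≤ 1`. Suppose the typed over-`K` input `MissingPPartOverCAt (W.baseChange K) p` — the
`p`-part of BSD for `E/K` on the base-changed model, Dokchitser–Dokchitser's `C(E/K)` — holds for
every quadratic field `K` whose twist `E^{(d_K)}` is multiplicative at `p` (then `p ∣ d_K` and `E_K`
is multiplicative at the prime above `p`). Then `BSD(E,p)`. Inputs, all published and carried as
named-fact binders: Greenberg–Vatsal 2000 at a multiplicative prime (`hGV`, flag
`GV00-mult-asserted`), Wuthrich 2014 Thm. 16 (`hWu`), Stein–Wuthrich 2013 (`hJs hJn hHs hHn`),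
Greenberg–Stevens for every curve at `p` (`hGS`), Milne 1972 any-model (`hMilneC`), GZK (`hGZK`),
modularity (`hmod`, `hpar`, `hnf`), Hoffstein–Luo 1997 (`hHL`). The twist pair is produced by
`ClassX3M.exists_gvPar_rankZero_mult_twist` and closed by the X2 owner's sub-cell X2a
(`bsdp_of_classX3M_of_gvPar_rankZero_twist'`). No census datum remains; X3♯(M) stays
CONSTRUCTION-SHAPED with exactly this over-`K` input missing (printed nowhere). [folklore] -/
theorem bsdp_of_classX3M [W.IsGloballyMinimal] (hGV : lambdaMu_multiplicative_of_gvPar)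
    (hWu : thm16_charIdeal_dvd_multiplicative_of_reducible)
    (hJs : thm61_splitMultiplicative) (hJn : thm61_nonsplitMultiplicative)
    (hHs : exists_isSplitMultCanonical) (hHn : exists_isMultCanonical)
    (hGZK : rank_eq_analyticRank_of_analyticRank_le_one) (hmod : hasEntireLFunction_rat)
    (hpar : nonempty_modularParametrizationData)
    (hMilneC : Milne1972.bsdQuotient_baseChange_quadratic_anyModel)
    (hnf : exists_isNewformOf) (hHL : HoffsteinLuo1997_exists_twist_L_one_ne_zero)
    (hGS : ∀ (V : WeierstrassCurve ℚ) [V.IsElliptic] [V.IsGloballyMinimal],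
      greenberg_stevens (W := V) (p := p))
    (hX : ClassX3M W p) (hr : W.analyticRank ≤ 1)
    (hK : ∀ (K : Type) [Field K] [NumberField K] (Wd : WeierstrassCurve ℚ) [Wd.IsElliptic]
      [Wd.IsGloballyMinimal], Module.finrank ℚ K = 2 →
      (∃ C : VariableChange ℚ, C • W.quadraticTwist (NumberField.discr K : ℚ) = Wd) →
      Mult Wd p → MissingPPartOverCAt (W.baseChange K) p) :
    BSDp W p := by
  obtain ⟨K, _, _, Wd, _, _, h2, hWd, hmult, hgv, hr0⟩ :=
    hX.exists_gvPar_rankZero_mult_twist hnf hHL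
  exact bsdp_of_classX3M_of_gvPar_rankZero_twist' W p K Wd hGV hWu hJs hJn hHs hHn hGZK hmod hpar
    hMilneC (hGS Wd) hX hr h2 hWd hmult hgv hr0 (hK K Wd h2 hWd hmult)

/-- **X3♯(M) ⇐ the `p`-part of BSD for `E` over every quadratic field** (plainer hypothesis, same
theorem): for `(E,p) ∈ X3♯(M)` of analytic rank `≤ 1`, if `MissingPPartOverCAt (W.baseChange K) p`
holds for every quadratic field `K`, then `BSD(E,p)` (binders as in `bsdp_of_classX3M`). [folklore] -/
theorem bsdp_of_classX3M_of_forall_quadratic [W.IsGloballyMinimal]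
    (hGV : lambdaMu_multiplicative_of_gvPar)
    (hWu : thm16_charIdeal_dvd_multiplicative_of_reducible)
    (hJs : thm61_splitMultiplicative) (hJn : thm61_nonsplitMultiplicative)
    (hHs : exists_isSplitMultCanonical) (hHn : exists_isMultCanonical)
    (hGZK : rank_eq_analyticRank_of_analyticRank_le_one) (hmod : hasEntireLFunction_rat)
    (hpar : nonempty_modularParametrizationData)
    (hMilneC : Milne1972.bsdQuotient_baseChange_quadratic_anyModel)
    (hnf : exists_isNewformOf) (hHL : HoffsteinLuo1997_exists_twist_L_one_ne_zero)
    (hGS : ∀ (V : WeierstrassCurve ℚ) [V.IsElliptic] [V.IsGloballyMinimal],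
      greenberg_stevens (W := V) (p := p))
    (hX : ClassX3M W p) (hr : W.analyticRank ≤ 1)
    (hK : ∀ (K : Type) [Field K] [NumberField K], Module.finrank ℚ K = 2 →
      MissingPPartOverCAt (W.baseChange K) p) :
    BSDp W p :=
  bsdp_of_classX3M hGV hWu hJs hJn hHs hHn hGZK hmod hpar hMilneC hnf hHL hGS hX hr
    fun K _ _ _ _ _ h2 _ _ ↦ hK K h2

/-- The uniform X3♯(M) theorem in the cell's `MissingPPartAt` currency (Partition / additive-p4's
`X3SharpM` bookkeeping): over-`K` input over the quadratic fields of `bsdp_of_classX3M` ⇒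
`MissingPPartAt W p`. [folklore] -/
theorem missingPPartAt_of_classX3M [W.IsGloballyMinimal] (hGV : lambdaMu_multiplicative_of_gvPar)
    (hWu : thm16_charIdeal_dvd_multiplicative_of_reducible)
    (hJs : thm61_splitMultiplicative) (hJn : thm61_nonsplitMultiplicative)
    (hHs : exists_isSplitMultCanonical) (hHn : exists_isMultCanonical)
    (hGZK : rank_eq_analyticRank_of_analyticRank_le_one) (hmod : hasEntireLFunction_rat)
    (hpar : nonempty_modularParametrizationData)
    (hMilneC : Milne1972.bsdQuotient_baseChange_quadratic_anyModel)
    (hnf : exists_isNewformOf) (hHL : HoffsteinLuo1997_exists_twist_L_one_ne_zero)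
    (hGS : ∀ (V : WeierstrassCurve ℚ) [V.IsElliptic] [V.IsGloballyMinimal],
      greenberg_stevens (W := V) (p := p))
    (hX : ClassX3M W p) (hr : W.analyticRank ≤ 1)
    (hK : ∀ (K : Type) [Field K] [NumberField K] (Wd : WeierstrassCurve ℚ) [Wd.IsElliptic]
      [Wd.IsGloballyMinimal], Module.finrank ℚ K = 2 →
      (∃ C : VariableChange ℚ, C • W.quadraticTwist (NumberField.discr K : ℚ) = Wd) →
      Mult Wd p → MissingPPartOverCAt (W.baseChange K) p) :
    MissingPPartAt W p := by
  haveI : Finite W.sha := (hGZK W hr).2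
  exact missingPPartAt_of_bsdp W p
    (bsdp_of_classX3M hGV hWu hJs hJn hHs hHn hGZK hmod hpar hMilneC hnf hHL hGS hX hr hK)

end Summit.BirchSwinnertonDyer.Rank1Residual.AdditivePotMult

end
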